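import Literature.Analysis.FluidPDE.PalasekObukhov.TowerEnvelope

/-!
# Palasek 2026, §3.1: "we may take N₀ > 1 large" — an explicit base for the blow-up tower

S. Palasek, *Finite-time blow-up in an elementary model of the 3D Navier–Stokes equations*,
arXiv:2605.13827 (2026), §3.1 p. 8 [Palasek2026ElementaryModel]: "for any choice of parameters
satisfying `c₃, c₄ > 0`, we may take `N₀ > 1` large to arrange that
`(N_{k+i₁}/N_{k+i₂})^{c₁}(A_{k+i₃}/A_{k+i₄})^{c₂}exp(-c₃(A_{k+1}/A_k)^{c₄})` is arbitrarily small,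
uniformly in `k ≥ 0`" ((exp_small)), and "`A_k/A_{k-1} ≤ (c/100)A_{k+1}/A_k` `∀ k ≥ 1`" ((ratios)).
In the tree these two sentences are the `∃ L₀` of `barrierHypotheses_exp`
(`PalasekObukhovBlowupProof.lean`, `N₀ = e^L`) and hence the `∃ N_*` of `barrierHypotheses_amp` /
`exists_isTowerSolution` (`PalasekObukhov/TowerEnvelope.lean`): the tower with its printed envelope
exists "for every base `N₀ ≥ N_*`", the threshold being produced by existence lemmas. § Scope of
`TowerEnvelope.lean` reads four of the standing inequalities backwards EXACTLY (necessary conditions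
on the base: `N₀^{2(α-β)(b-1)} ≥ 12`, `N₀^{2(α-β)(b-1)b} ≥ 16`, `νcN₀^{2-β} ≤ log(3/2)`,
`4ν ≤ N₀^{β-2b}`). This file supplies the converse direction: an EXPLICIT closed-form base
`towerThreshold b β α ν` from which ALL the standing inequalities hold, so that
`exists_isTowerSolution` becomes `isTowerSolution_of_towerThreshold_le` — the same existence theorem
with its `N_*` displayed. MODEL bookkeeping (the range of the printed proof of an ODE shell model);
nothing here is about Navier–Stokes, and nothing is asserted about the model below the threshold.

* `affine_le_mul_exp_of_le`, `mul_exp_le_exp_exp_of_le`: (exp_small) with a LOGARITHMIC explicit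
  threshold: `Py + C ≤ κe^{Qy}` as soon as `Qy ≥ 2` and `Qy ≥ 2 log(2(P/Q + C⁺)/κ)` (the tree's
  `exists_affine_le_mul_exp` carries the witness `max{1, 4(|P|+|C|)/(κQ²)}` — correct, but a threshold
  of order `e^{10⁴}` at the exponents below).
* `four_mul_exp_le_exp_exp`: the one double-exponential condition of the bundle,
  `4e^{2βb²y} ≤ exp(κe^{β(b-1)y})`, from `β(b-1)y ≥ max{2, 2 log(2(2b²/(b-1) + log 4)/κ)}`;
  `fifth_mul_exp_le_of_four_mul_exp_le`: it implies the (E1)-condition of the tree's `E1_exp`.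
* `V2_exp_twelve`, `key_exp_of`, `S4_exp_eight`: the fields (V2) and (S4) of the tree's bundle
  `BarrierHypotheses` with threshold-friendly constants — (V2) with its own constant `12` (the tree's
  `V2_exp` asks `16`), and (S4) with the split `1/10 = 1/100 + 9/100` of the exponent
  `(1/10)A_k/A_{k-1}`, under which the two floor terms `(1/20)A_{k-1}/A_{k-2} + 5A_{k-2}/A_{k-3}` are
  absorbed as soon as consecutive amplitude RATIOS grow by the factor `8` (`8 ≤ N₀^{β(b-1)²}`; the
  tree's `S4_exp` asks `101 ≤ N₁^{β(b-1)²}`).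
* `barrierHypotheses_exp_explicit` / `barrierHypotheses_amp_explicit`: the bundle
  `BarrierHypotheses (amp N₀ b β) (delta N₀ b α) (νN₀²) (1/10)` together with the viscous absorption
  `νN_k² ≤ ¼A_{k-1}` from SIX itemised conditions on the base: `3ν/10 ≤ N₀^{β-2}` (V1),
  `12 ≤ N₀^{2(α-β)(b-1)}` (V2), `16 ≤ N₀^{2(α-β)(b-1)b}` (S2, every level), `4ν ≤ N₀^{β-2b}`
  (absorption, every level), `8 ≤ N₀^{β(b-1)²}` (S4 floors),
  `β(b-1)log N₀ ≥ 2max{1, log(200(2b²/(b-1) + log 4))}` (the double exponentials of S1/E1/S4).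
* `towerThresholdLog`, `towerThreshold` (definitions with bodies: the maximum of the six closed
  forms, and its exponential), `towerThresholdLog_pos`, `one_lt_towerThreshold`,
  `barrierHypotheses_of_towerThreshold_le`, `isTowerSolution_of_towerThreshold_le`,
  `exists_isTowerSolution_explicit`.
* `towerThresholdLog_wide_le`, `le_towerThresholdLog_wide`, `towerThreshold_wide_bounds`,
  `isTowerSolution_wide_of_exp_le`: the worked instance below CHECKED BY THE KERNEL (from
  `Real.log_two_lt_d9`, `Real.log_two_gt_d9`, `Real.exp_one_gt_d9`): at
  `(b, β, α, ν) = (11/10, 23/10, 49/20, 1)`, `90 ≤ towerThresholdLog ≤ 181/2`, so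
  `e^{90} ≤ towerThreshold ≤ e^{90.5}`, and the tower exists for every base `N₀ ≥ e^{90.5}`.

Worked numbers (MODEL bookkeeping, repeated in the docstring of `towerThresholdLog`): at the
exponents `(b, β, α) = (11/10, 23/10, 49/20)` registered by the cell `pub/ns-blowup` and `ν = 1` the
six pieces are `log(3/10)/(3/10) < 0`, `log 12/(3/100) ≈ 82.8`, `log 16/(33/1000) ≈ 84.0`,
`log 4/(1/10) ≈ 13.9`, `log 8/(23/1000) ≈ 90.4`, `2 log(200(121/5 + log 4))/(23/100) ≈ 74.3`, so
`log towerThreshold ≈ 90.4`, `towerThreshold ≈ 10^{39.3}`. With § Scope of `TowerEnvelope.lean` (the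
bundle FAILS below `16^{1000/33} ≈ 10^{36.5}`): at these exponents the tree's sufficient conditions for
Palasek's tower begin between `10^{36.5}` and `10^{39.3}`.

Everything is PROVED (standard axioms); the only definitions are the two thresholds, with bodies;
there are no new named facts and no new analysis beyond `exp`/`log` inequalities. The bundle
`BarrierHypotheses` and the field lemmas `S1_exp`, `E1_exp`, `S2_exp`, `V1_exp`, `visc_exp`,
`key_exp`, `expDelta_le_one`, `expAmp_ratio_step` are the tree's (`PalasekObukhovBlowupProof.lean`);
`isTowerSolution_of_barrierHypotheses` is in `PalasekObukhov/TowerEnvelope.lean`.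
-/

open Set Filter
open scoped Topology

noncomputable section

namespace Literature.Analysis.FluidPDE

namespace PalasekObukhov

/-! ### (exp_small) with an explicit logarithmic threshold -/

section ExpSmall

/-- **(exp_small), explicit.** For `κ, Q > 0`, `P ≥ 0` and any `C`: if `Qy ≥ 2` and
`Qy ≥ 2 log(2M)` with `M = (P/Q + max{C, 0})/κ`, then `Py + C ≤ κe^{Qy}`. (With `x = Qy ≥ 2`:
`Py + C ≤ κMx`, while `e^x = e^{x/2}e^{x/2} ≥ 2M · x/2`.) A logarithmic replacement for the witness
`max{1, 4(|P|+|C|)/(κQ²)}` inside the tree's `exists_affine_le_mul_exp`.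
[cite: Palasek2026ElementaryModel, §3.1 (exp_small) p. 8: "we may take N₀ > 1 large to arrange that … is arbitrarily small"] -/
theorem affine_le_mul_exp_of_le {P C κ Q y : ℝ} (hκ : 0 < κ) (hQ : 0 < Q) (hP : 0 ≤ P)
    (h2 : 2 ≤ Q * y) (hM : 2 * Real.log (2 * ((P / Q + max C 0) / κ)) ≤ Q * y) :
    P * y + C ≤ κ * Real.exp (Q * y) := by
  set x := Q * y with hx
  set M := (P / Q + max C 0) / κ with hMdef
  have hM0 : 0 ≤ M := by positivity
  have hx1 : 1 ≤ x := by linarith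
  -- the affine side is at most `κ M x`
  have h1 : P * y + C ≤ κ * M * x := by
    have hκM : κ * M = P / Q + max C 0 := by
      rw [hMdef, mul_div_assoc', mul_div_cancel_left₀ _ hκ.ne']
    have hC : C ≤ max C 0 * x :=
      (le_max_left C 0).trans (le_mul_of_one_le_right (le_max_right C 0) hx1)
    have hPy : P / Q * x = P * y := by
      rw [hx, ← mul_assoc, div_mul_cancel₀ P hQ.ne']
    rw [hκM, add_mul, hPy]
    linarith
  -- `2M ≤ e^{x/2}` and `x/2 ≤ e^{x/2}`
  have h2M : 2 * M ≤ Real.exp (x / 2) := by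
    rcases eq_or_lt_of_le hM0 with h0 | hpos
    · rw [← h0, mul_zero]
      exact (Real.exp_pos _).le
    · calc 2 * M = Real.exp (Real.log (2 * M)) := (Real.exp_log (by positivity)).symm
        _ ≤ Real.exp (x / 2) := Real.exp_le_exp.2 (by linarith)
  have h3 : x / 2 ≤ Real.exp (x / 2) := by linarith [Real.add_one_le_exp (x / 2)]
  have h4 : M * x ≤ Real.exp x := by
    have he : Real.exp x = Real.exp (x / 2) * Real.exp (x / 2) := by
      rw [← Real.exp_add]
      congr 1
      ring
    rw [he]
    calc M * x = 2 * M * (x / 2) := by ring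
      _ ≤ Real.exp (x / 2) * Real.exp (x / 2) :=
          mul_le_mul h2M h3 (by linarith) (Real.exp_pos _).le
  calc P * y + C ≤ κ * M * x := h1
    _ = κ * (M * x) := by ring
    _ ≤ κ * Real.exp x := mul_le_mul_of_nonneg_left h4 hκ.le

/-- Multiplicative form of `affine_le_mul_exp_of_le`: `Ke^{Py} ≤ exp(κe^{Qy})` once `Qy ≥ 2` and
`Qy ≥ 2 log(2(P/Q + max{log K, 0})/κ)` (`K, κ, Q > 0`, `P ≥ 0`).
[cite: Palasek2026ElementaryModel, §3.1 (exp_small) p. 8] -/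
theorem mul_exp_le_exp_exp_of_le {K P κ Q y : ℝ} (hK : 0 < K) (hκ : 0 < κ) (hQ : 0 < Q)
    (hP : 0 ≤ P) (h2 : 2 ≤ Q * y)
    (hM : 2 * Real.log (2 * ((P / Q + max (Real.log K) 0) / κ)) ≤ Q * y) :
    K * Real.exp (P * y) ≤ Real.exp (κ * Real.exp (Q * y)) := by
  have h := affine_le_mul_exp_of_le (C := Real.log K) hκ hQ hP h2 hM
  calc K * Real.exp (P * y) = Real.exp (Real.log K + P * y) := by
        rw [Real.exp_add, Real.exp_log hK]
    _ ≤ Real.exp (κ * Real.exp (Q * y)) := Real.exp_le_exp.2 (by linarith)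

/-- **The double-exponential condition of the bundle, explicit.** For `b > 1`, `β > 0`, `κ > 0`:
`4e^{2βb²y} ≤ exp(κe^{β(b-1)y})` as soon as `β(b-1)y ≥ 2` and
`β(b-1)y ≥ 2 log(2(2b²/(b-1) + log 4)/κ)`. This is the hypothesis `h4` of the tree's `key_exp` /
`S1_exp` (`κ = 1/20`) and of `S4_exp_eight` below (`κ = 1/100`), at `y = b^{k-1}log N₀`: the
back-reaction prefactor `4δ_kA_{k+1}²/(A_iA_k) ≤ 4N₀^{2βb²b^{k-1}}` against `exp(κA_k/A_{k-1})`,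
`A_k/A_{k-1} = N₀^{β(b-1)b^{k-1}}`.
[cite: Palasek2026ElementaryModel, §3.1 (exp_small) p. 8, as invoked in the proof of Lemma 3.2, Cases 1–2 ("can be made arbitrarily small with the choice of N₀, using (exp_small) and (ratios)")] -/
theorem four_mul_exp_le_exp_exp {b β κ y : ℝ} (hb : 1 < b) (hβ : 0 < β) (hκ : 0 < κ)
    (h2 : 2 ≤ β * (b - 1) * y)
    (hM : 2 * Real.log (2 * ((2 * b ^ 2 / (b - 1) + Real.log 4) / κ)) ≤ β * (b - 1) * y) :
    4 * Real.exp (2 * β * b ^ 2 * y) ≤ Real.exp (κ * Real.exp (β * (b - 1) * y)) := by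
  have hq : 0 < b - 1 := by linarith
  have hQ : 0 < β * (b - 1) := mul_pos hβ hq
  have hPQ : 2 * β * b ^ 2 / (β * (b - 1)) + max (Real.log 4) 0 = 2 * b ^ 2 / (b - 1) + Real.log 4 := by
    rw [max_eq_left (Real.log_nonneg (by norm_num))]
    congr 1
    rw [div_eq_div_iff (mul_ne_zero hβ.ne' hq.ne') hq.ne']
    ring
  exact mul_exp_le_exp_exp_of_le (by norm_num) hκ hQ (by positivity) h2 (by rwa [hPQ])

/-- The (E1)-condition of the tree's `E1_exp` follows from the `h4`-condition:
`(1/5)e^{βby} ≤ 4e^{2βb²y}` for `b ≥ 1`, `β, y ≥ 0`.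
[cite: Palasek2026ElementaryModel, §3.1 Lemma 3.2 (eta_global_bound), proof (p. 9)] -/
theorem fifth_mul_exp_le_of_four_mul_exp_le {b β y X : ℝ} (hb : 1 ≤ b) (hβ : 0 ≤ β) (hy : 0 ≤ y)
    (h4 : 4 * Real.exp (2 * β * b ^ 2 * y) ≤ X) :
    1 / 5 * Real.exp (β * b * y) ≤ X := by
  refine le_trans ?_ h4
  have h1 : Real.exp (β * b * y) ≤ Real.exp (2 * β * b ^ 2 * y) := by
    refine Real.exp_le_exp.2 ?_
    have h0 : 0 ≤ β * b * y := by positivity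
    nlinarith [mul_le_mul_of_nonneg_left hb h0]
  linarith [Real.exp_pos (β * b * y)]

end ExpSmall

/-! ### The fields (V2) and (S4) with threshold-friendly constants -/

section Fields

variable {b β α L ν : ℝ}

/-- `(e^z)² = e^{2z}`. [folklore] -/
private theorem texp_sq (z : ℝ) : Real.exp z ^ 2 = Real.exp (2 * z) := by
  rw [← Real.exp_nat_mul]
  norm_num

/-- `Ke^u ≤ e^v` once `K ≤ e^{v-u}`. [folklore] -/
private theorem tmul_exp_le_exp {K u v : ℝ} (h : K ≤ Real.exp (v - u)) :
    K * Real.exp u ≤ Real.exp v := by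
  calc K * Real.exp u ≤ Real.exp (v - u) * Real.exp u :=
        mul_le_mul_of_nonneg_right h (Real.exp_pos u).le
    _ = Real.exp v := by rw [← Real.exp_add, sub_add_cancel]

/-- (V2) for the exponential data with ITS OWN constant: `12δ₀A₁² ≤ A₀²` as soon as
`12 ≤ e^{2(α-β)(b-1)L}` (`= N₀^{2(α-β)(b-1)}`; this is also necessary,
`twelve_mul_delta_mul_amp_sq_le_iff`). The tree's `V2_exp` asks `16`.
[cite: Palasek2026ElementaryModel, §3.1 Lemma 3.2 proof, Case 1 (p. 8)] -/
theorem V2_exp_twelve (h12 : 12 ≤ Real.exp (2 * (α - β) * (b - 1) * L)) :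
    12 * expDelta b α L 0 * expAmp b β L 1 ^ 2 ≤ expAmp b β L 0 ^ 2 := by
  rw [expDelta_eq, expAmp, expAmp, texp_sq, texp_sq, mul_assoc, ← Real.exp_add]
  refine tmul_exp_le_exp (h12.trans (le_of_eq ?_))
  congr 1
  simp only [pow_zero, pow_one, mul_one]
  ring

/-- The tree's `key_exp` with the absorbed fraction `κ` of `A_k/A_{k-1}` as a parameter:
`4δ_kA_{k+1}²/(A_iA_k) ≤ exp(κA_k/A_{k-1})`, given the double-exponential condition with constant
`κ` at `y = b^{k-1}L` (the algebra `δ_kA_{k+1}²/(A_iA_k) ≤ e^{2βb²b^{k-1}L}` is unchanged).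
[cite: Palasek2026ElementaryModel, §3.1 (exp_small), proof of Lemma 3.2, Cases 1–2 (p. 8)] -/
theorem key_exp_of (hb : 1 ≤ b) (hβ : 0 ≤ β) (hα : 0 ≤ α) (hL : 0 ≤ L) {k : ℕ} (i : ℕ)
    (hk : 1 ≤ k) (κ : ℝ)
    (h4 : 4 * Real.exp (2 * β * b ^ 2 * (b ^ (k - 1) * L)) ≤
      Real.exp (κ * Real.exp (β * (b - 1) * (b ^ (k - 1) * L)))) :
    4 * (expDelta b α L k * expAmp b β L (k + 1) ^ 2 / (expAmp b β L i * expAmp b β L k)) ≤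
      Real.exp (κ * (expAmp b β L k / expAmp b β L (k - 1))) := by
  rw [expAmp_ratio_eq b β L hk]
  refine le_trans (mul_le_mul_of_nonneg_left ?_ (by norm_num)) h4
  rw [expDelta_eq, expAmp, expAmp, expAmp, texp_sq, ← Real.exp_add, ← Real.exp_add,
    ← Real.exp_sub]
  refine Real.exp_le_exp.2 ?_
  have hbk : ∀ n : ℕ, 1 ≤ b ^ n := fun n => one_le_pow₀ hb
  have e1 : b ^ (k + 1) = b ^ (k - 1) * b ^ 2 := by rw [← pow_add]; congr 1; omega
  have t1 : 0 ≤ 2 * α * (b - 1) * b ^ k * L := by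
    have := hbk k
    have : 0 ≤ b - 1 := by linarith
    positivity
  have t2 : 0 ≤ β * b ^ i * L := by have := hbk i; positivity
  have t3 : 0 ≤ β * b ^ k * L := by have := hbk k; positivity
  rw [e1]
  linarith

/-- **(S4) for the exponential data (`k ≥ 3`) under ratio growth `8`.** The exponent
`(1/10)A_k/A_{k-1}` on the left of (S4) is split as `1/100 + 9/100`: the first part absorbs the
back-reaction prefactor (the double-exponential condition with `κ = 1/100`, `h4`), the second absorbs
the two floor terms `(1/20)A_{k-1}/A_{k-2} + 5A_{k-2}/A_{k-3}` as soon as the consecutive ratios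
`A_j/A_{j-1}` grow by the factor `8` from `j = k-2` on, i.e. `8 ≤ exp(β(b-1)²b^{k-3}L)` (`h8`; indeed
`(9/100)·8 ≥ 1/20 + 5/8`). The tree's `S4_exp` uses the split `1/20 + 1/20` and the growth factor
`101` one index higher.
[cite: Palasek2026ElementaryModel, §3.2 proof of Prop. 3.3, case t < t_k (p. 9); §3.1 (ratios)] -/
theorem S4_exp_eight (hb : 1 ≤ b) (hβ : 0 ≤ β) (hL : 0 < L) (hα : 0 ≤ α) {k : ℕ} (hk : 3 ≤ k)
    (h4 : 4 * Real.exp (2 * β * b ^ 2 * (b ^ (k - 1) * L)) ≤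
      Real.exp (1 / 100 * Real.exp (β * (b - 1) * (b ^ (k - 1) * L))))
    (h8 : 8 ≤ Real.exp (β * (b - 1) ^ 2 * (b ^ (k - 3) * L))) :
    4 * expDelta b α L k * expAmp b β L (k + 1) ^ 2 *
        Real.exp (expAmp b β L k * tk (expAmp b β L) (1 / 10) (k + 1)) ≤
      expAmp b β L (k - 1) * expAmp b β L k *
        Real.exp (expAmp b β L (k - 1) / 2 * tk (expAmp b β L) (1 / 10) k -
          5 * (expAmp b β L (k - 2) / expAmp b β L (k - 3))) := by
  set A := expAmp b β L with hA
  set δ := expDelta b α L with hδ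
  have hApos : ∀ k, 0 < A k := expAmp_pos b β L
  have htk1 : A k * tk A (1 / 10) (k + 1) = -(1 / 10 * (A k / A (k - 1))) := by
    show A k * -(1 / 10 / A (k + 1 - 2)) = _
    rw [show k + 1 - 2 = k - 1 by omega]
    ring
  have htk : A (k - 1) / 2 * tk A (1 / 10) k = -(1 / 20 * (A (k - 1) / A (k - 2))) := by
    show A (k - 1) / 2 * -(1 / 10 / A (k - 2)) = _
    ring
  -- the three consecutive ratios and their growth by the factor `8`
  have hr : A k / A (k - 1) = Real.exp (β * (b - 1) * (b ^ (k - 1) * L)) :=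
    expAmp_ratio_eq b β L (by omega)
  have hr₁ : A (k - 1) / A (k - 2) = Real.exp (β * (b - 1) * (b ^ (k - 2) * L)) := by
    have := expAmp_ratio_eq b β L (k := k - 1) (by omega)
    rwa [show k - 1 - 1 = k - 2 by omega] at this
  have hr₂ : A (k - 2) / A (k - 3) = Real.exp (β * (b - 1) * (b ^ (k - 3) * L)) := by
    have := expAmp_ratio_eq b β L (k := k - 2) (by omega)
    rwa [show k - 2 - 1 = k - 3 by omega] at this
  have e2 : b ^ (k - 1) = b ^ (k - 2) * b := by rw [← pow_succ]; congr 1; omega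
  have e3 : b ^ (k - 2) = b ^ (k - 3) * b := by rw [← pow_succ]; congr 1; omega
  have hb3 : 0 ≤ b ^ (k - 3) := by have := one_le_pow₀ (n := k - 3) hb; linarith
  have hq : 0 ≤ b - 1 := by linarith
  have h0 : 0 ≤ β * (b - 1) ^ 2 * (b ^ (k - 3) * L) := by positivity
  have hg₁ : 8 * (A (k - 2) / A (k - 3)) ≤ A (k - 1) / A (k - 2) := by
    rw [hr₁, hr₂]
    refine tmul_exp_le_exp (h8.trans (le_of_eq ?_))
    congr 1
    rw [e3]
    ring
  have hg₂ : 8 * (A (k - 1) / A (k - 2)) ≤ A k / A (k - 1) := by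
    rw [hr, hr₁]
    refine tmul_exp_le_exp (h8.trans (Real.exp_le_exp.2 ?_))
    rw [e2, e3]
    nlinarith [mul_nonneg h0 hq, mul_nonneg (mul_nonneg h0 hq) hq]
  rw [htk1, htk]
  have hK := key_exp_of hb hβ hα hL.le (k - 1) (show 1 ≤ k by omega) (1 / 100) h4
  have hAk := hApos k
  have hAk1 := hApos (k - 1)
  have hδ0 : 0 ≤ δ k := by rw [hδ, expDelta_eq]; exact (Real.exp_pos _).le
  have h2 : 4 * (δ k * A (k + 1) ^ 2) ≤
      A (k - 1) * A k * Real.exp (1 / 100 * (A k / A (k - 1))) := by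
    have h3 : δ k * A (k + 1) ^ 2 / (A (k - 1) * A k) * (A (k - 1) * A k) =
        δ k * A (k + 1) ^ 2 := by
      field_simp
    have h5 := mul_le_mul_of_nonneg_right hK (mul_pos hAk1 hAk).le
    rw [mul_assoc, h3] at h5
    linarith
  have hρ0 : 0 < A (k - 2) / A (k - 3) := div_pos (hApos _) (hApos _)
  have hexp : Real.exp (1 / 100 * (A k / A (k - 1))) *
        Real.exp (-(1 / 10 * (A k / A (k - 1)))) ≤
      Real.exp (-(1 / 20 * (A (k - 1) / A (k - 2))) - 5 * (A (k - 2) / A (k - 3))) := by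
    rw [← Real.exp_add]
    refine Real.exp_le_exp.2 ?_
    linarith
  have hpos := Real.exp_pos (-(1 / 10 * (A k / A (k - 1))))
  calc 4 * δ k * A (k + 1) ^ 2 * Real.exp (-(1 / 10 * (A k / A (k - 1))))
      = 4 * (δ k * A (k + 1) ^ 2) * Real.exp (-(1 / 10 * (A k / A (k - 1)))) := by ring
    _ ≤ A (k - 1) * A k * Real.exp (1 / 100 * (A k / A (k - 1))) *
          Real.exp (-(1 / 10 * (A k / A (k - 1)))) := mul_le_mul_of_nonneg_right h2 hpos.le
    _ = A (k - 1) * A k * (Real.exp (1 / 100 * (A k / A (k - 1))) *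
          Real.exp (-(1 / 10 * (A k / A (k - 1))))) := by ring
    _ ≤ A (k - 1) * A k * Real.exp (-(1 / 20 * (A (k - 1) / A (k - 2))) -
          5 * (A (k - 2) / A (k - 3))) :=
        mul_le_mul_of_nonneg_left hexp (mul_pos hAk1 hAk).le

end Fields

/-! ### The standing inequalities from six explicit conditions on the base -/

section Explicit

variable {b β α L ν N₀ : ℝ}

/-- **The standing inequalities of §3.1 at an explicit base — exponential parametrisation**
(`N₀ = e^L`, `N_k = e^{b^kL}`, `A_k = e^{βb^kL}`, `δ_k = e^{-2α(b-1)b^kL}`, `μ₀ = νN₀²`, `c = 1/10`).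
For `ν ≥ 0`, `1 < b`, `2b < β < α` and `L > 0`, the tree's bundle `BarrierHypotheses`, the viscous
absorption `νN_k² ≤ ¼A_{k-1}` (`k ≥ 1`), `δ_k ≤ 1` and the monotonicity of `A_{k+1}/A_k` hold as soon
as: `3ν/10 ≤ e^{(β-2)L}` (V1), `12 ≤ e^{2(α-β)(b-1)L}` (V2), `16 ≤ e^{2(α-β)(b-1)bL}` (S2 at every
level `k ≥ 1`, by monotonicity in `k`), `4ν ≤ e^{(β-2b)L}` (absorption at every level),
`8 ≤ e^{β(b-1)²L}` (the floors in S4), and `β(b-1)L ≥ 2max{1, log(200(2b²/(b-1) + log 4))}` (the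
double exponentials of S1/E1/S4 at every `y = b^jL ≥ L`, constants `1/100` and hence `1/20`). This is
`barrierHypotheses_exp` with its `∃ L₀` replaced by displayed inequalities.
[cite: Palasek2026ElementaryModel, §3.1 (exp_small), (ratios), (viscous_A_assumptions) (p. 8); Lemma 3.2 and Prop. 3.3–3.4 proofs (pp. 8–10)] -/
theorem barrierHypotheses_exp_explicit (hν : 0 ≤ ν) (hb : 1 < b) (hβ2b : 2 * b < β)
    (hβα : β < α) (hL : 0 < L)
    (hV1 : 3 * ν / 10 ≤ Real.exp ((β - 2) * L))
    (hV2 : 12 ≤ Real.exp (2 * (α - β) * (b - 1) * L))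
    (hS2 : 16 ≤ Real.exp (2 * (α - β) * (b - 1) * b * L))
    (hvisc : 4 * ν ≤ Real.exp ((β - 2 * b) * L))
    (hS4 : 8 ≤ Real.exp (β * (b - 1) ^ 2 * L))
    (hD : 2 * max 1 (Real.log (200 * (2 * b ^ 2 / (b - 1) + Real.log 4))) ≤ β * (b - 1) * L) :
    BarrierHypotheses (expAmp b β L) (expDelta b α L) (ν * scale (Real.exp L) b 0 ^ 2) (1 / 10) ∧
    (∀ k, 1 ≤ k → ν * scale (Real.exp L) b k ^ 2 ≤ expAmp b β L (k - 1) / 4) ∧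
    (∀ k, expDelta b α L k ≤ 1) ∧
    (∀ k, expAmp b β L (k + 1) / expAmp b β L k ≤
      expAmp b β L (k + 2) / expAmp b β L (k + 1)) := by
  have hb1 : 1 ≤ b := hb.le
  have hq : 0 < b - 1 := by linarith
  have hβ0 : 0 < β := by linarith
  have hβ0' : 0 ≤ β := hβ0.le
  have hα0 : 0 ≤ α := by linarith
  have hQ : 0 < β * (b - 1) := mul_pos hβ0 hq
  have hyk : ∀ n : ℕ, L ≤ b ^ n * L := le_pow_mul hb1 hL.le
  -- the double-exponential condition at every `y ≥ L`, constants `1/100` and `1/20`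
  have hmax1 := le_max_left (1 : ℝ) (Real.log (200 * (2 * b ^ 2 / (b - 1) + Real.log 4)))
  have hmax2 := le_max_right (1 : ℝ) (Real.log (200 * (2 * b ^ 2 / (b - 1) + Real.log 4)))
  have hD2 : 2 ≤ β * (b - 1) * L := by linarith
  have hDM : 2 * Real.log (2 * ((2 * b ^ 2 / (b - 1) + Real.log 4) / (1 / 100))) ≤
      β * (b - 1) * L := by
    have e : 2 * ((2 * b ^ 2 / (b - 1) + Real.log 4) / (1 / 100)) =
        200 * (2 * b ^ 2 / (b - 1) + Real.log 4) := by ring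
    rw [e]
    linarith
  have h100 : ∀ y, L ≤ y → 4 * Real.exp (2 * β * b ^ 2 * y) ≤
      Real.exp (1 / 100 * Real.exp (β * (b - 1) * y)) := by
    intro y hy
    have hmono : β * (b - 1) * L ≤ β * (b - 1) * y := mul_le_mul_of_nonneg_left hy hQ.le
    exact four_mul_exp_le_exp_exp hb hβ0 (by norm_num) (hD2.trans hmono) (hDM.trans hmono)
  have h20 : ∀ y, L ≤ y → 4 * Real.exp (2 * β * b ^ 2 * y) ≤
      Real.exp (1 / 20 * Real.exp (β * (b - 1) * y)) := by
    intro y hy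
    refine (h100 y hy).trans (Real.exp_le_exp.2 ?_)
    exact mul_le_mul_of_nonneg_right (by norm_num) (Real.exp_pos _).le
  refine ⟨⟨expAmp_pos b β L, expAmp_mono hb1 hβ0' hL.le, fun k => ?_, by norm_num, ?_, ?_, ?_,
    ?_, ?_, ?_, ?_, ?_⟩, ?_, expDelta_le_one hb1 hα0 hL.le, ?_⟩
  · rw [expDelta_eq]; exact (Real.exp_pos _).le
  · have := Real.add_one_le_exp (-(2 * (1 / 10 : ℝ)))
    linarith
  · positivity
  · -- (V1)
    refine V1_exp ?_
    have e : 3 * ν * (1 / 10) = 3 * ν / 10 := by ring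
    rw [e]
    exact hV1
  · -- (V2)
    exact V2_exp_twelve hV2
  · -- (S1)
    exact fun k hk => S1_exp hb1 hβ0' hL hα0 hk (h20 _ (hyk _))
  · -- (S2), every level from the level-1 instance
    intro k hk
    refine S2_exp k (hS2.trans (Real.exp_le_exp.2 ?_))
    have hbk : b ≤ b ^ k := by
      calc b = b ^ 1 := (pow_one b).symm
        _ ≤ b ^ k := pow_le_pow_right₀ hb1 hk
    have h0 : 0 ≤ 2 * (α - β) * (b - 1) * L := by
      have : 0 ≤ α - β := by linarith
      positivity
    nlinarith [mul_le_mul_of_nonneg_left hbk h0]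
  · -- (E1)
    intro j hj
    refine E1_exp hb1 hβ0' hL.le hj ?_
    have hy : L ≤ b ^ (j - 2) * L := hyk _
    exact fifth_mul_exp_le_of_four_mul_exp_le hb1 hβ0' (hL.le.trans hy) (h20 _ hy)
  · -- (S4)
    intro k hk
    refine S4_exp_eight hb1 hβ0' hL hα0 hk (h100 _ (hyk _))
      (hS4.trans (Real.exp_le_exp.2 ?_))
    have h0 : 0 ≤ β * (b - 1) ^ 2 := by positivity
    exact mul_le_mul_of_nonneg_left (hyk _) h0
  · -- viscous absorption, every level from the base instance
    intro k hk
    refine visc_exp hk (hvisc.trans (Real.exp_le_exp.2 ?_))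
    have h0 : 0 ≤ β - 2 * b := by linarith
    exact mul_le_mul_of_nonneg_left (hyk _) h0
  · intro k
    have := expAmp_ratio_step hb1 hβ0' hL.le (k + 2) (by omega)
    simpa using this

/-- **The standing inequalities at an explicit base — tower coordinates.** For `ν ≥ 0`, `1 < b`,
`2b < β < α` and a base `N₀ > 1`, the tree's bundle
`BarrierHypotheses (amp N₀ b β) (delta N₀ b α) (νN₀²) (1/10)` (the finitely many consequences of
(exp_small)/(ratios) used by Lemma 3.2 and Props. 3.3–3.4) and the viscous absorption
`νN_k² ≤ ¼A_{k-1}` (`k ≥ 1`) hold as soon as SIX power conditions hold at the base: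
`3ν/10 ≤ N₀^{β-2}` (V1: the mode-`0` reservoir), `12 ≤ N₀^{2(α-β)(b-1)}` (V2) and
`16 ≤ N₀^{2(α-β)(b-1)b}` (S2) (the back-reaction smallness of Lemma 3.2 Cases 1–2 — both also
NECESSARY, § Scope of `TowerEnvelope.lean`), `4ν ≤ N₀^{β-2b}` (absorption, `β > 2b` — also necessary),
`8 ≤ N₀^{β(b-1)²}` (ratio growth absorbing the floors in S4), and
`β(b-1)log N₀ ≥ 2max{1, log(200(2b²/(b-1) + log 4))}` (the double exponentials of S1/E1/S4).
[cite: Palasek2026ElementaryModel, §3.1 (exp_small) "we may take N₀ > 1 large", (ratios), (viscous_A_assumptions) (p. 8)] -/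
theorem barrierHypotheses_amp_explicit (hν : 0 ≤ ν) (hb : 1 < b) (hβ2b : 2 * b < β)
    (hβα : β < α) (hN₀ : 1 < N₀)
    (hV1 : 3 * ν / 10 ≤ N₀ ^ (β - 2))
    (hV2 : 12 ≤ N₀ ^ (2 * (α - β) * (b - 1)))
    (hS2 : 16 ≤ N₀ ^ (2 * (α - β) * (b - 1) * b))
    (hvisc : 4 * ν ≤ N₀ ^ (β - 2 * b))
    (hS4 : 8 ≤ N₀ ^ (β * (b - 1) ^ 2))
    (hD : 2 * max 1 (Real.log (200 * (2 * b ^ 2 / (b - 1) + Real.log 4))) ≤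
      β * (b - 1) * Real.log N₀) :
    BarrierHypotheses (amp N₀ b β) (delta N₀ b α) (ν * N₀ ^ 2) (1 / 10) ∧
    (∀ k, 1 ≤ k → ν * scale N₀ b k ^ 2 ≤ amp N₀ b β (k - 1) / 4) := by
  have hN₀pos : 0 < N₀ := lt_trans one_pos hN₀
  have hL : 0 < Real.log N₀ := Real.log_pos hN₀
  have hpow : ∀ e : ℝ, N₀ ^ e = Real.exp (e * Real.log N₀) := fun e => by
    rw [Real.rpow_def_of_pos hN₀pos, mul_comm]
  rw [hpow] at hV1 hV2 hS2 hvisc hS4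
  obtain ⟨hH, hv, -, -⟩ :=
    barrierHypotheses_exp_explicit (α := α) hν hb hβ2b hβα hL hV1 hV2 hS2 hvisc hS4 hD
  have hA : expAmp b β (Real.log N₀) = amp N₀ b β := by
    funext k
    rw [amp_eq_exp hN₀pos]
    rfl
  have hδ : expDelta b α (Real.log N₀) = delta N₀ b α := by
    funext k
    simp only [expDelta, delta, Real.exp_log hN₀pos]
  have hs0 : scale N₀ b 0 = N₀ := by simp [scale]
  rw [hA, hδ, Real.exp_log hN₀pos, hs0] at hH
  rw [hA, Real.exp_log hN₀pos] at hv
  exact ⟨hH, hv⟩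

/-! ### The explicit base `N_*(b, β, α, ν)` -/

/-- **`log N_*`: an explicit base exponent for Palasek's tower.** The maximum of the six closed forms
solving the conditions of `barrierHypotheses_amp_explicit` for `log N₀`:
`log(3ν/10)/(β-2)` (V1), `log 12/(2(α-β)(b-1))` (V2), `log 16/(2(α-β)(b-1)b)` (S2),
`log(4ν)/(β-2b)` (absorption), `log 8/(β(b-1)²)` (S4 floors),
`2max{1, log(200(2b²/(b-1) + log 4))}/(β(b-1))` (double exponentials). Worked numbers, MODEL
bookkeeping only: at `(b, β, α, ν) = (11/10, 23/10, 49/20, 1)` the six pieces are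
`≈ -4.0, 82.8, 84.0, 13.9, 90.4, 74.3`, so `towerThresholdLog ≈ 90.4` and
`towerThreshold = e^{90.4…} ≈ 10^{39.3}`; § Scope of `TowerEnvelope.lean` shows the bundle fails below
`16^{1000/33} ≈ 10^{36.5}` at these exponents, so the binding piece is the S4 ratio-growth condition
and the two bounds differ by the factor `≈ 10^{2.8}`.
[cite: Palasek2026ElementaryModel, §3.1 (exp_small) p. 8: "we may take N₀ > 1 large"; (ratios); (viscous_A_assumptions)] -/
def towerThresholdLog (b β α ν : ℝ) : ℝ :=
  max (max (max (Real.log (3 * ν / 10) / (β - 2)) (Real.log 12 / (2 * (α - β) * (b - 1))))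
      (max (Real.log 16 / (2 * (α - β) * (b - 1) * b)) (Real.log (4 * ν) / (β - 2 * b))))
    (max (Real.log 8 / (β * (b - 1) ^ 2))
      (2 * max 1 (Real.log (200 * (2 * b ^ 2 / (b - 1) + Real.log 4))) / (β * (b - 1))))

/-- **`N_* = exp(towerThresholdLog)`: an explicit base for Palasek's tower** (every `N₀ ≥ N_*` carries
the standing inequalities and a tower solution, `isTowerSolution_of_towerThreshold_le`).
[cite: Palasek2026ElementaryModel, §3.1 (exp_small) p. 8: "we may take N₀ > 1 large"] -/
def towerThreshold (b β α ν : ℝ) : ℝ :=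
  Real.exp (towerThresholdLog b β α ν)

/-- `towerThresholdLog > 0` (its S2 piece `log 16/(2(α-β)(b-1)b)` is positive for `b > 1`, `β < α`).
[cite: Palasek2026ElementaryModel, §3.1 (exp_small) p. 8] -/
theorem towerThresholdLog_pos (hb : 1 < b) (hβα : β < α) : 0 < towerThresholdLog b β α ν := by
  have hq : 0 < b - 1 := by linarith
  have hαβ : 0 < α - β := by linarith
  have hb0 : 0 < b := by linarith
  have h : 0 < Real.log 16 / (2 * (α - β) * (b - 1) * b) := by
    have : 0 < Real.log 16 := Real.log_pos (by norm_num)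
    positivity
  exact lt_of_lt_of_le h (le_max_of_le_left (le_max_of_le_right (le_max_left _ _)))

/-- `N_* > 1`. [cite: Palasek2026ElementaryModel, §3.1 (exp_small) p. 8: "N₀ > 1 large"] -/
theorem one_lt_towerThreshold (hb : 1 < b) (hβα : β < α) : 1 < towerThreshold b β α ν := by
  unfold towerThreshold
  exact Real.one_lt_exp_iff.2 (towerThresholdLog_pos hb hβα)

/-- **The standing inequalities from the explicit base.** For `ν ≥ 0`, `1 < b`, `2b < β < α` and
every `N₀ ≥ towerThreshold b β α ν`, the schedule `A_k = N_k^β`, `δ_k = (N_k/N_{k+1})^{2α}`,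
`μ₀ = νN₀²`, `c = 1/10` satisfies the tree's bundle `BarrierHypotheses` and the viscous absorption
`νN_k² ≤ ¼A_{k-1}` (`k ≥ 1`) — `barrierHypotheses_amp` with its `N_*` displayed.
[cite: Palasek2026ElementaryModel, §3.1 (exp_small), (ratios), (viscous_A_assumptions) (p. 8)] -/
theorem barrierHypotheses_of_towerThreshold_le (hν : 0 ≤ ν) (hb : 1 < b) (hβ2b : 2 * b < β)
    (hβα : β < α) (hN₀ : towerThreshold b β α ν ≤ N₀) :
    BarrierHypotheses (amp N₀ b β) (delta N₀ b α) (ν * N₀ ^ 2) (1 / 10) ∧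
    (∀ k, 1 ≤ k → ν * scale N₀ b k ^ 2 ≤ amp N₀ b β (k - 1) / 4) := by
  have hN₀1 : 1 < N₀ := lt_of_lt_of_le (one_lt_towerThreshold hb hβα) hN₀
  have hN₀pos : 0 < N₀ := lt_trans one_pos hN₀1
  have hTL : towerThresholdLog b β α ν ≤ Real.log N₀ := (Real.le_log_iff_exp_le hN₀pos).2 hN₀
  have hq : 0 < b - 1 := by linarith
  have hαβ : 0 < α - β := by linarith
  have hβ2 : 0 < β - 2 := by linarith
  have hβ2b' : 0 < β - 2 * b := by linarith
  have hβ0 : 0 < β := by linarith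
  have hb0 : 0 < b := by linarith
  have hpow : ∀ e : ℝ, N₀ ^ e = Real.exp (e * Real.log N₀) := fun e => by
    rw [Real.rpow_def_of_pos hN₀pos, mul_comm]
  -- the six pieces of the maximum
  have h1 : Real.log (3 * ν / 10) / (β - 2) ≤ Real.log N₀ :=
    le_trans (le_max_of_le_left (le_max_of_le_left (le_max_left _ _))) hTL
  have h2 : Real.log 12 / (2 * (α - β) * (b - 1)) ≤ Real.log N₀ :=
    le_trans (le_max_of_le_left (le_max_of_le_left (le_max_right _ _))) hTL
  have h3 : Real.log 16 / (2 * (α - β) * (b - 1) * b) ≤ Real.log N₀ :=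
    le_trans (le_max_of_le_left (le_max_of_le_right (le_max_left _ _))) hTL
  have h4 : Real.log (4 * ν) / (β - 2 * b) ≤ Real.log N₀ :=
    le_trans (le_max_of_le_left (le_max_of_le_right (le_max_right _ _))) hTL
  have h5 : Real.log 8 / (β * (b - 1) ^ 2) ≤ Real.log N₀ :=
    le_trans (le_max_of_le_right (le_max_left _ _)) hTL
  have h6 : 2 * max 1 (Real.log (200 * (2 * b ^ 2 / (b - 1) + Real.log 4))) / (β * (b - 1)) ≤
      Real.log N₀ :=
    le_trans (le_max_of_le_right (le_max_right _ _)) hTL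
  refine barrierHypotheses_amp_explicit hν hb hβ2b hβα hN₀1 ?_ ?_ ?_ ?_ ?_ ?_
  · -- (V1)
    rw [hpow]
    rcases eq_or_lt_of_le hν with h0 | hνpos
    · have e : 3 * ν / 10 = 0 := by rw [← h0]; ring
      rw [e]
      exact (Real.exp_pos _).le
    · rw [div_le_iff₀ hβ2] at h1
      calc 3 * ν / 10 = Real.exp (Real.log (3 * ν / 10)) := (Real.exp_log (by positivity)).symm
        _ ≤ Real.exp ((β - 2) * Real.log N₀) := Real.exp_le_exp.2 (by linarith)
  · -- (V2)
    rw [hpow]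
    have hd : 0 < 2 * (α - β) * (b - 1) := by positivity
    rw [div_le_iff₀ hd] at h2
    calc (12 : ℝ) = Real.exp (Real.log 12) := (Real.exp_log (by norm_num)).symm
      _ ≤ Real.exp (2 * (α - β) * (b - 1) * Real.log N₀) := Real.exp_le_exp.2 (by linarith)
  · -- (S2)
    rw [hpow]
    have hd : 0 < 2 * (α - β) * (b - 1) * b := by positivity
    rw [div_le_iff₀ hd] at h3
    calc (16 : ℝ) = Real.exp (Real.log 16) := (Real.exp_log (by norm_num)).symm
      _ ≤ Real.exp (2 * (α - β) * (b - 1) * b * Real.log N₀) := Real.exp_le_exp.2 (by linarith)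
  · -- absorption
    rw [hpow]
    rcases eq_or_lt_of_le hν with h0 | hνpos
    · have e : 4 * ν = 0 := by rw [← h0]; ring
      rw [e]
      exact (Real.exp_pos _).le
    · rw [div_le_iff₀ hβ2b'] at h4
      calc 4 * ν = Real.exp (Real.log (4 * ν)) := (Real.exp_log (by positivity)).symm
        _ ≤ Real.exp ((β - 2 * b) * Real.log N₀) := Real.exp_le_exp.2 (by linarith)
  · -- (S4) floors
    rw [hpow]
    have hd : 0 < β * (b - 1) ^ 2 := by positivity
    rw [div_le_iff₀ hd] at h5
    calc (8 : ℝ) = Real.exp (Real.log 8) := (Real.exp_log (by norm_num)).symm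
      _ ≤ Real.exp (β * (b - 1) ^ 2 * Real.log N₀) := Real.exp_le_exp.2 (by linarith)
  · -- double exponentials
    have hd : 0 < β * (b - 1) := by positivity
    rw [div_le_iff₀ hd] at h6
    linarith

/-- **Existence of the tower at every base above the explicit threshold** — the tree's
`exists_isTowerSolution` (Prop. 3.4 for every truncation order, the `K → ∞` limit and the `C^∞`
bootstrap, for every large base) with its `N_*` displayed: for `ν ≥ 0`, `1 < b`, `2b < β < α` and
every `N₀ ≥ towerThreshold b β α ν` there is a tower solution with `c = 1/10` and the printed
envelope (`IsTowerSolution`). MODEL statement; at the cell's registered exponents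
`(11/10, 23/10, 49/20)` and `ν = 1` this covers exactly the bases `N₀ ≥ towerThreshold ≈ 10^{39.3}`
(`towerThresholdLog`), and says nothing below.
[cite: Palasek2026ElementaryModel, §3.3 Prop. 3.4 and proof of Thm 1.3 (p. 10); §3.1 (exp_small) "we may take N₀ > 1 large" (p. 8)] -/
theorem isTowerSolution_of_towerThreshold_le (hν : 0 ≤ ν) (hb : 1 < b) (hβ2b : 2 * b < β)
    (hβα : β < α) (hN₀ : towerThreshold b β α ν ≤ N₀) :
    ∃ x : ℝ → ℕ → ℝ, IsTowerSolution ν α N₀ b β (1 / 10) x := by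
  obtain ⟨hH, hvisc⟩ := barrierHypotheses_of_towerThreshold_le hν hb hβ2b hβα hN₀
  have hN₀1 : 1 < N₀ := lt_of_lt_of_le (one_lt_towerThreshold hb hβα) hN₀
  exact isTowerSolution_of_barrierHypotheses hν hN₀1 hb.le (by linarith) hH hvisc

/-- `exists_isTowerSolution` with the witness `N_* := towerThreshold b β α ν` named.
[cite: Palasek2026ElementaryModel, §3.3 Prop. 3.4 and proof of Thm 1.3 (p. 10); §3.1 (exp_small) (p. 8)] -/
theorem exists_isTowerSolution_explicit (hν : 0 ≤ ν) (hb : 1 < b) (hβ2b : 2 * b < β)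
    (hβα : β < α) :
    1 < towerThreshold b β α ν ∧ ∀ N₀ : ℝ, towerThreshold b β α ν ≤ N₀ →
      ∃ x : ℝ → ℕ → ℝ, IsTowerSolution ν α N₀ b β (1 / 10) x :=
  ⟨one_lt_towerThreshold hb hβα, fun _ h => isTowerSolution_of_towerThreshold_le hν hb hβ2b hβα h⟩

end Explicit

/-! ### Worked instance: the threshold at the cell's registered exponents, kernel-checked -/

section Worked

/-- **`90 ≤ log N_* ≤ 90.5` at `(b, β, α, ν) = (11/10, 23/10, 49/20, 1)`** — the worked numbers of
`towerThresholdLog` checked by the kernel from `Real.log_two_lt_d9` / `Real.log_two_gt_d9` /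
`Real.exp_one_gt_d9`: the binding piece is the (S4) ratio-growth condition `log 8/(23/1000) ≈ 90.41`;
the (V2)/(S2) pieces are `≤ 2.715/(3/100)`, `≤ 4 log 2/(33/1000)`, the absorption piece `2 log 2/(1/10)`,
the double-exponential piece `≤ 2·10/(23/100)`, the (V1) piece is negative. Hence
`e^{90} ≤ towerThreshold ≤ e^{90.5}` (`≈ 10^{39.1}`–`10^{39.3}`), `towerThreshold_wide_bounds`. MODEL
bookkeeping only (exponents registered by the cell `pub/ns-blowup`; nothing about Navier–Stokes).
[cite: Palasek2026ElementaryModel, §3.1 (exp_small) p. 8: "we may take N₀ > 1 large"] -/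
theorem towerThresholdLog_wide_le : towerThresholdLog (11 / 10) (23 / 10) (49 / 20) 1 ≤ 181 / 2 := by
  have hl2 := Real.log_two_lt_d9
  have hlog4 : Real.log 4 = 2 * Real.log 2 := by
    rw [show (4 : ℝ) = 2 ^ 2 by norm_num, Real.log_pow]
    norm_num
  have hlog8 : Real.log 8 = 3 * Real.log 2 := by
    rw [show (8 : ℝ) = 2 ^ 3 by norm_num, Real.log_pow]
    norm_num
  have hlog16 : Real.log 16 = 4 * Real.log 2 := by
    rw [show (16 : ℝ) = 2 ^ 4 by norm_num, Real.log_pow]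
    norm_num
  have he1 := Real.exp_one_gt_d9
  unfold towerThresholdLog
  refine max_le (max_le (max_le ?_ ?_) (max_le ?_ ?_)) (max_le ?_ ?_)
  · -- (V1): `log(3/10) < 0`
    have hneg : Real.log (3 * 1 / 10) < 0 := Real.log_neg (by norm_num) (by norm_num)
    rw [div_le_iff₀ (by norm_num : (0 : ℝ) < 23 / 10 - 2)]
    linarith
  · -- (V2): `log 12 ≤ 2.715` from `12 ≤ e·e·(1 + 0.715)`
    rw [div_le_iff₀ (by norm_num : (0 : ℝ) < 2 * (49 / 20 - 23 / 10) * (11 / 10 - 1)),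
      Real.log_le_iff_le_exp (by norm_num : (0 : ℝ) < 12)]
    have h := Real.add_one_le_exp (143 / 200 : ℝ)
    have e : (181 / 2 : ℝ) * (2 * (49 / 20 - 23 / 10) * (11 / 10 - 1)) = 1 + 1 + 143 / 200 := by
      norm_num
    rw [e, Real.exp_add, Real.exp_add]
    have h7 : (7389 / 1000 : ℝ) ≤ Real.exp 1 * Real.exp 1 := by nlinarith [Real.exp_pos (1 : ℝ)]
    linarith [mul_le_mul h7 h (by norm_num)
      (mul_pos (Real.exp_pos (1 : ℝ)) (Real.exp_pos (1 : ℝ))).le]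
  · -- (S2): `4 log 2 ≤ 2.9865`
    rw [div_le_iff₀ (by norm_num : (0 : ℝ) < 2 * (49 / 20 - 23 / 10) * (11 / 10 - 1) * (11 / 10)),
      hlog16]
    linarith
  · -- absorption: `2 log 2 ≤ 9.05`
    rw [div_le_iff₀ (by norm_num : (0 : ℝ) < 23 / 10 - 2 * (11 / 10)),
      show (4 : ℝ) * 1 = 4 by norm_num, hlog4]
    linarith
  · -- (S4) floors: `3 log 2 ≤ 2.0815` (the binding piece, `≈ 2.0794`)
    rw [div_le_iff₀ (by norm_num : (0 : ℝ) < 23 / 10 * (11 / 10 - 1) ^ 2), hlog8]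
    linarith
  · -- double exponentials: `log(200(121/5 + log 4)) ≤ 10` from `5200 ≤ 2.718^10 ≤ e^10`
    rw [div_le_iff₀ (by norm_num : (0 : ℝ) < 23 / 10 * (11 / 10 - 1))]
    have hlog4pos : 0 < Real.log 4 := Real.log_pos (by norm_num)
    have hpos : (0 : ℝ) < 200 * (2 * (11 / 10) ^ 2 / (11 / 10 - 1) + Real.log 4) := by
      linarith
    have hmax : max 1 (Real.log (200 * (2 * (11 / 10 : ℝ) ^ 2 / (11 / 10 - 1) + Real.log 4))) ≤
        10 := by
      refine max_le (by norm_num) ?_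
      rw [Real.log_le_iff_le_exp hpos]
      have h4 : Real.log 4 < 13863 / 10000 := by rw [hlog4]; linarith
      have hpow : (2.7182818283 : ℝ) ^ 10 ≤ Real.exp 1 ^ 10 :=
        pow_le_pow_left₀ (by norm_num) he1.le 10
      have hexp10 : Real.exp 1 ^ 10 = Real.exp 10 := by
        rw [← Real.exp_nat_mul]
        norm_num
      have hnum : (5200 : ℝ) ≤ (2.7182818283 : ℝ) ^ 10 := by norm_num
      rw [← hexp10]
      linarith
    linarith

/-- `90 ≤ log N_*` at the registered exponents (the (S4) piece alone: `3 log 2/(23/1000) ≥ 90`).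
[cite: Palasek2026ElementaryModel, §3.1 (exp_small) p. 8] -/
theorem le_towerThresholdLog_wide : 90 ≤ towerThresholdLog (11 / 10) (23 / 10) (49 / 20) 1 := by
  have hl2 := Real.log_two_gt_d9
  have hlog8 : Real.log 8 = 3 * Real.log 2 := by
    rw [show (8 : ℝ) = 2 ^ 3 by norm_num, Real.log_pow]
    norm_num
  unfold towerThresholdLog
  refine le_trans ?_ (le_max_of_le_right (le_max_left _ _))
  rw [le_div_iff₀ (by norm_num : (0 : ℝ) < 23 / 10 * (11 / 10 - 1) ^ 2), hlog8]
  linarith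

/-- **`e^{90} ≤ N_* ≤ e^{90.5}` at `(b, β, α, ν) = (11/10, 23/10, 49/20, 1)`** (`≈ 10^{39.1}` to
`10^{39.3}`). MODEL bookkeeping only. [cite: Palasek2026ElementaryModel, §3.1 (exp_small) p. 8] -/
theorem towerThreshold_wide_bounds :
    Real.exp 90 ≤ towerThreshold (11 / 10) (23 / 10) (49 / 20) 1 ∧
      towerThreshold (11 / 10) (23 / 10) (49 / 20) 1 ≤ Real.exp (181 / 2) :=
  ⟨Real.exp_le_exp.2 le_towerThresholdLog_wide, Real.exp_le_exp.2 towerThresholdLog_wide_le⟩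

/-- **Palasek's tower at the cell's registered exponents exists for every base `N₀ ≥ e^{90.5}`**
(`ν = 1`, `c = 1/10`): the MODEL existence theorem `exists_isTowerSolution` with a NUMERIC base.
Nothing is asserted below `e^{90.5} ≈ 10^{39.3}` (and § Scope of `TowerEnvelope.lean`: the tree's
bundle fails below `16^{1000/33} ≈ 10^{36.5}`); nothing here is about Navier–Stokes.
[cite: Palasek2026ElementaryModel, §3.3 Prop. 3.4 and proof of Thm 1.3 (p. 10); §3.1 (exp_small) (p. 8)] -/
theorem isTowerSolution_wide_of_exp_le {N₀ : ℝ} (hN₀ : Real.exp (181 / 2) ≤ N₀) :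
    ∃ x : ℝ → ℕ → ℝ, IsTowerSolution 1 (49 / 20) N₀ (11 / 10) (23 / 10) (1 / 10) x :=
  isTowerSolution_of_towerThreshold_le (by norm_num) (by norm_num) (by norm_num) (by norm_num)
    (towerThreshold_wide_bounds.2.trans hN₀)

end Worked

end PalasekObukhov

end Literature.Analysis.FluidPDE

end
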